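import Summits.HodgeConjecture.HodgeConjecture.Theses.EndoscopicMiddleDegree
import Summits.HodgeConjecture.HodgeConjecture.Theorems.EndoscopicMiddleDegreeMiddleThetaSpanHeckeIdempotents
import Literature.AlgebraicGeometry.ShimuraVarieties.HeckeCorrespondenceAction
import Literature.AlgebraicTopology.SingularHomology.CohomologyRingChangeFunctoriality
import Literature.AlgebraicTopology.SingularHomology.IntegralClassRingChange
import Literature.AlgebraicGeometry.HodgeTheory.RationalClassesRingChange

/-!
# Stub `stub_killedBarren` (line `purity-sorted-hecke-envelope` of crux
# `EndoscopicMiddleDegree.OrthogonalEnveloped`, stmt-HodgeConjecture-14300): killed blocks are barren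

Registered skeleton `Cruxes/OrthogonalEnveloped/Lines/purity_sorted_hecke_envelope.lean`; this is the file
`Theorems/EndoscopicMiddleDegreeOrthogonalEnvelopedKilledBarren.lean` of the summit
(`--supports stmt-HodgeConjecture-14300`). Vocabulary (`IsCentralIdempotent`,
`IsPrimitiveCentralIdempotent`, `exists_primitiveCentralIdempotents`) from its home
`Theorems/EndoscopicMiddleDegreeMiddleThetaSpanHeckeIdempotents.lean`; the coefficient conjugation
`conjEnd σ a = σ_* ∘ a ∘ σ_*⁻¹` from `Literature/AlgebraicTopology/SingularHomology/
CohomologyRingChangeFunctoriality.lean`.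

WHAT IS PROVED (`stub_killedBarren`, signature byte-identical with the registered stub). For `m ∈ {1,2}`,
a datum `D` on `X`, `H = H²ⁿ(X(ℂ); ℂ)` (`n = m + 1`) and the Hecke algebra
`𝓗 = Algebra.adjoin ℂ (range T_g) ⊆ End_ℂ H`, `T_g = D.heckeCorrespondenceAction (2n) g`, GRANTED that
`𝓗` preserves the Hodge type `(n,n)` (hypothesis `hH`): a central idempotent `ε` of `𝓗` which is KILLED —
every ℂ-block `z ≤ ε` (primitive central idempotent `z` of `𝓗` with `z ε = z`) has, for some
`σ ∈ Aut(ℂ)`, a coefficient-conjugate `conjEnd σ z` whose image contains no non-zero `(n,n)`-class —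
annihilates every RATIONAL class `e` of type `(n,n)`.

HOW (BMM arXiv:1306.1515 Part 2 §1.9; Hatcher §3.1 p. 198 / §3.G p. 321 for the change of
coefficients). (1) `ε = ε · 1 = Σ_{z} ε z` over the ℂ-blocks `z` of `𝓗`
(`exists_primitiveCentralIdempotents`; `H` is finite-dimensional by `finite_complexBetti`), and
`ε z ∈ {0, z}` by primitivity of `z` applied to the central idempotent `ε`; so it suffices that
`z e = 0` for every block `z` with `z ε = z`. (2) For such `z` pick `σ`. (3) `conjEnd σ` fixes every
generator `T_g = [Γ' : N_g]⁻¹ · τ ∘ π_g^*` (`σ_*` commutes with the transfer `τ`,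
`ringChange_transferMap`, with the pull-back `π_g^*`, `singularCohomology.ringChange_map`, and fixes the
rational scalar), hence maps `𝓗` into itself (`Algebra.adjoin_induction`; `conjEnd` is additive,
multiplicative and `σ`-semilinear on scalars): `conjEnd σ z ∈ 𝓗`. (4) By `hH`, `(conjEnd σ z) e` is of
type `(n,n)`, hence `0` by the choice of `σ`. (5) `(conjEnd σ z) e = σ_* (z (σ_*⁻¹ e)) = σ_* (z e)`
because `σ_*⁻¹` fixes the rational class `e` (`isRationalClass_iff_exists_ringChange`,
`ringChange_comp_apply`, uniqueness of ring maps `ℚ → ℂ`), and `σ_*` is injective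
(`ringChange_equiv_injective`): `z e = 0`. The hypotheses `1 ≤ m ≤ 2` are not used. No named facts.
-/

noncomputable section

namespace Summit.HodgeConjecture.HodgeConjecture.Cruxes.OrthogonalEnveloped.PuritySortedHeckeEnvelope

open scoped BigOperators
open Literature.AlgebraicGeometry.Motives (SchemeOver ComplexPoints IsSmoothProjective)
open Literature.AlgebraicGeometry.HodgeTheory
open Literature.AlgebraicGeometry.ShimuraVarieties
open Literature.AlgebraicTopology.SingularHomology
open Summit.HodgeConjecture.HodgeConjecture.Cruxes.MiddleThetaSpan.ConjugateDimensionSieve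
  (IsCentralIdempotent IsPrimitiveCentralIdempotent exists_primitiveCentralIdempotents conjAct)

-- The crux-workfile namespace `Summit.<P>.<Sub>.Cruxes.…` repeats `HodgeConjecture` (single-conjunct summit).
set_option linter.dupNamespace false

variable {p : ℕ} {X : SchemeOver ℂ}

/-! ## `σ_*` fixes rational classes and the Hecke operators `T_g` -/

/-- **`σ_*` fixes rational classes**: for `σ ∈ Aut(ℂ)` and a rational class `c = ι_* x`
(`ι : ℚ ↪ ℂ`), `σ_* c = (σ ∘ ι)_* x = ι_* x = c`, since `σ ∘ ι = ι` (a ring homomorphism out of `ℚ`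
is unique). [cite: HatcherAT2002, §3.1 p. 198] -/
theorem killedBarren_ringChange_eq_self (σ : ℂ ≃+* ℂ) (k : ℕ) {c : complexBetti X k}
    (hc : IsRationalClass c) :
    singularCohomology.ringChange (σ : ℂ →+* ℂ) (ComplexPoints X) k c = c := by
  obtain ⟨x, rfl⟩ := (isRationalClass_iff_exists_ringChange c).1 hc
  rw [← ringChange_comp_apply,
    Subsingleton.elim ((σ : ℂ →+* ℂ).comp (algebraMap ℚ ℂ)) (algebraMap ℚ ℂ)]

/-- **`conjEnd σ` fixes every Hecke operator** `T_g = [Γ' : N_g]⁻¹ · τ ∘ π_g^*`: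
`σ_* ∘ T_g ∘ σ_*⁻¹ = T_g`, because the change of coefficients acts on the VALUES of cochains while
transfer and pull-back act on the simplices (`ringChange_transferMap`,
`singularCohomology.ringChange_map`), and `σ` fixes the rational normalising scalar. (Junk case
`T_g = 0` for non-admissible `g`: `conjEnd σ 0 = 0`.) [cite: BergeronMillsonMoeglin2016Balls, Part 2 §1.9]
[cite: HatcherAT2002, §3.G p. 321] -/
theorem killedBarren_conjEnd_heckeCorrespondenceAction (D : UnitaryBallQuotientDatum p X)
    (σ : ℂ ≃+* ℂ) (k : ℕ) (g : GL (Fin (p + 1)) D.E) :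
    conjEnd σ (D.heckeCorrespondenceAction k g) = D.heckeCorrespondenceAction k g := by
  by_cases h : D.IsHeckeAdmissible g
  · haveI : (D.heckeLevel g).FiniteIndex := h.finiteIndex
    letI : Fintype (↥D.Γ ⧸ D.heckeLevel g) := Subgroup.fintypeQuotientOfFiniteIndex
    refine LinearMap.ext fun x => ?_
    rw [conjEnd_apply, D.heckeCorrespondenceAction_apply h k, D.heckeCorrespondenceAction_apply h k]
    dsimp only
    rw [ringChange_equiv_smul, ringChange_transferMap, singularCohomology.ringChange_map,
      ringChange_symm_apply, map_inv₀, map_natCast]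
  · rw [D.heckeCorrespondenceAction_of_not h, conjEnd_zero]

/-- **`conjEnd σ` maps the Hecke algebra `𝓗 = Algebra.adjoin ℂ (range T_g)` into itself**: it is
additive, multiplicative, sends the scalar `r • 1` to `σ(r) • 1` and fixes the generators `T_g`
(induction on the adjunction). [cite: BergeronMillsonMoeglin2016Balls, Part 2 §1.9] -/
theorem killedBarren_conjEnd_mem_adjoin (D : UnitaryBallQuotientDatum p X) (σ : ℂ ≃+* ℂ) (k : ℕ)
    {a : Module.End ℂ (complexBetti X k)}
    (ha : a ∈ Algebra.adjoin ℂ (Set.range (D.heckeCorrespondenceAction k))) :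
    conjEnd σ a ∈ Algebra.adjoin ℂ (Set.range (D.heckeCorrespondenceAction k)) := by
  induction ha using Algebra.adjoin_induction with
  | mem T hT =>
    obtain ⟨g, rfl⟩ := hT
    rw [killedBarren_conjEnd_heckeCorrespondenceAction]
    exact Algebra.subset_adjoin ⟨g, rfl⟩
  | algebraMap r =>
    rw [conjEnd_algebraMap]
    exact Subalgebra.algebraMap_mem _ _
  | add a b _ _ iha ihb =>
    rw [conjEnd_add]
    exact Subalgebra.add_mem _ iha ihb
  | mul a b _ _ iha ihb =>
    rw [conjEnd_mul]
    exact Subalgebra.mul_mem _ iha ihb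

/-! ## One killed ℂ-block kills every rational `(n,n)`-class -/

/-- **A killed ℂ-block kills rational classes of the preserved type.** If the subalgebra-free datum is:
`a ∈ End_ℂ Hᵏ(X(ℂ); ℂ)`, `σ ∈ Aut(ℂ)` such that `(conjEnd σ a) e` is of type `(p', q')` only if it
vanishes, and `(conjEnd σ a) e` IS of type `(p', q')`, then for RATIONAL `e`: `a e = 0` — because
`(conjEnd σ a) e = σ_* (a (σ_*⁻¹ e)) = σ_* (a e)` (`σ_*⁻¹` fixes `e`) and `σ_*` is injective.
[cite: BergeronMillsonMoeglin2016Balls, Part 2 §1.9] -/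
theorem killedBarren_apply_eq_zero_of_conjEnd (σ : ℂ ≃+* ℂ) (k : ℕ)
    (a : Module.End ℂ (complexBetti X k)) {e : complexBetti X k} (he : IsRationalClass e)
    (h0 : conjEnd σ a e = 0) : a e = 0 := by
  rw [conjEnd_apply, killedBarren_ringChange_eq_self σ.symm k he] at h0
  refine ringChange_equiv_injective σ ?_
  rw [map_zero]
  exact h0

/-! ## The registered stub (signature must stay BYTE-IDENTICAL) -/

/-- **Stub 4 — KILLED BLOCKS ARE BARREN: the coefficient-conjugation SIEVE for blocks of the Hecke
algebra (the absolute-Hodge-free lever of the parent crux's landed `stub_sieve`, re-cut for this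
line).** Let `m ∈ {1,2}`, `D` a datum, `𝓗 = Algebra.adjoin ℂ (range T_g)` the Hecke algebra on
`H = H²ⁿ(X(ℂ); ℂ)`, and GRANT that `𝓗` preserves the type `(n,n)` (`hH`). Let `ε` be a central
idempotent of `𝓗` which is KILLED: every ℂ-block `z` of `𝓗` below `ε` (a primitive central idempotent
with `z ε = z`) has, for some `σ ∈ Aut(ℂ)`, a coefficient-conjugate `conjEnd σ z = σ_* ∘ z ∘ σ_*⁻¹`
whose image contains no non-zero class of type `(n,n)`. Then `ε` kills every RATIONAL class `e` of
type `(n,n)`. Proof: `ε = Σ_{z ≤ ε} z` over the ℂ-blocks (`exists_primitiveCentralIdempotents 𝓗`: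
`Σ z = 1`, and `ε z ∈ {0, z}` by primitivity of `z`); for such `z` pick `σ`; `conjEnd σ z ∈ 𝓗`
(`killedBarren_conjEnd_mem_adjoin`), so `(conjEnd σ z) e` is of type `(n,n)` by `hH`, hence `0`; but
`(conjEnd σ z) e = σ_*(z (σ_*⁻¹ e)) = σ_*(z e)` because `e` is rational, and `σ_*` is injective:
`z e = 0` (`killedBarren_apply_eq_zero_of_conjEnd`). Rationality of `e` is consumed exactly once,
through conjugation of COEFFICIENTS — no absolute-Hodge input, no conjugate variety.
[cite: BergeronMillsonMoeglin2016Balls, Part 2 §1.9] [cite: HatcherAT2002, §3.1 p. 198] -/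
theorem stub_killedBarren :
    ∀ (m : ℕ) (X : SchemeOver ℂ) (D : UnitaryBallQuotientDatum (2 * (m + 1)) X), 1 ≤ m → m ≤ 2 →
      (∀ a ∈ Algebra.adjoin ℂ (Set.range (D.heckeCorrespondenceAction (2 * (m + 1)))),
        ∀ c : complexBetti X (2 * (m + 1)),
          IsOfHodgeType (2 * (m + 1)) X (2 * (m + 1)) (m + 1) (m + 1) c →
            IsOfHodgeType (2 * (m + 1)) X (2 * (m + 1)) (m + 1) (m + 1) (a c)) →
      ∀ ε : Module.End ℂ (complexBetti X (2 * (m + 1))),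
        ε ∈ Algebra.adjoin ℂ (Set.range (D.heckeCorrespondenceAction (2 * (m + 1)))) →
        ε * ε = ε →
        (∀ T ∈ Algebra.adjoin ℂ (Set.range (D.heckeCorrespondenceAction (2 * (m + 1)))),
          T * ε = ε * T) →
        (∀ z : Module.End ℂ (complexBetti X (2 * (m + 1))),
          IsPrimitiveCentralIdempotent
              (Algebra.adjoin ℂ (Set.range (D.heckeCorrespondenceAction (2 * (m + 1))))) z →
            z * ε = z →
              ∃ σ : ℂ ≃+* ℂ, ∀ c : complexBetti X (2 * (m + 1)),
                IsOfHodgeType (2 * (m + 1)) X (2 * (m + 1)) (m + 1) (m + 1) (conjEnd σ z c) →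
                  conjEnd σ z c = 0) →
        ∀ e : complexBetti X (2 * (m + 1)), IsRationalClass e →
          IsOfHodgeType (2 * (m + 1)) X (2 * (m + 1)) (m + 1) (m + 1) e → ε e = 0 := by
  intro m X D _ _ hH ε hε hεε hεc hK e he hHe
  haveI := finite_complexBetti D.isSmoothProjective (2 * (m + 1))
  obtain ⟨Z, hZ, hZ1⟩ := exists_primitiveCentralIdempotents
    (Algebra.adjoin ℂ (Set.range (D.heckeCorrespondenceAction (2 * (m + 1)))))
  -- every ℂ-block `z ≤ ε` kills `e`
  have key : ∀ z ∈ Z, z * ε = z → z e = 0 := fun z hz hzε => by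
    obtain ⟨σ, hσ⟩ := hK z (hZ z hz) hzε
    exact killedBarren_apply_eq_zero_of_conjEnd σ _ z he
      (hσ e (hH _ (killedBarren_conjEnd_mem_adjoin D σ _ (hZ z hz).1.1) e hHe))
  -- `ε = ε * Σ z = Σ ε z`, and `ε z ∈ {0, z}` blockwise
  have hεZ : ε = ∑ z ∈ Z, ε * z := by rw [← Finset.mul_sum, hZ1, mul_one]
  rw [hεZ, LinearMap.sum_apply]
  refine Finset.sum_eq_zero fun z hz => ?_
  rcases (hZ z hz).2.2 ε ⟨hε, hεε, hεc⟩ with h0 | h0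
  · rw [h0, LinearMap.zero_apply]
  · rw [h0]
    exact key z hz (((hεc z (hZ z hz).1.1)).trans h0)

end Summit.HodgeConjecture.HodgeConjecture.Cruxes.OrthogonalEnveloped.PuritySortedHeckeEnvelope

end
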